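import Literature.RepresentationTheory.FiniteGroups.InvolutionCommutatorTrace
import Literature.NumberTheory.EllipticCurves.MatarNekovar2019.IrreducibleOverQuadraticFieldClauseThreeProofs
import Literature.NumberTheory.EllipticCurves.SupersingularDensitySerreTraceProofs
import Literature.NumberTheory.EllipticCurves.GaloisActionProofs
import Literature.NumberTheory.EllipticCurves.OrdinaryPrimesProofs
import Literature.NumberTheory.EllipticCurves.LFunctionPrimeCoeff
import Literature.NumberTheory.GaloisRepresentations.FrobeniusDensity
import Literature.NumberTheory.GaloisRepresentations.ModNCyclotomicCharacter
import Literature.NumberTheory.Automorphic.ChebotarevArtinRepHolds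
import Mathlib.LinearAlgebra.Trace
import HarnessLib

/-!
# Irreducible `E[p]` (`p` odd): good primes `ℓ ≡ 1` modulo any modulus with `a_ℓ(E) ≢ 2 (mod p)`
# — proofs only

Topic `Literature/NumberTheory/EllipticCurves`; namespace `Literature.NumberTheory.EllipticCurves`.
THEOREMS ONLY (no definition, no named fact, no instance).

For an elliptic curve `E = W/ℚ` in global minimal form and an odd prime `p` with `E[p]`
IRREDUCIBLE (`WeierstrassCurve.HasIrreducibleModPGaloisRep`: the only `Γ_ℚ`-stable subgroups of
`E[p]` are `⊥`, `⊤`), for every modulus `M ≥ 1` and every finite set `S` of primes there is a prime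
`ℓ ∉ S`, `ℓ ≠ p`, `ℓ ∤ M Δ_min(W)` (so of good reduction), with

  `ℓ ≡ 1 (mod M)` and `a_ℓ(W) ≢ 2 (mod p)`

(`exists_prime_modEq_one_not_dvd_frobeniusTrace_sub_two`), and its `p = 3`, `M = N_W`,
`L`-series-coefficient form `exists_prime_modEq_one_conductorNorm_not_three_dvd_lFunction_sub_two`
(`∃ ℓ ≠ 3`, `ℓ ≡ 1 (mod N_W)`, `3 ∤ a_ℓ - 2` with `a_ℓ = W.LFunction ℓ`).

## Proof (assembly of tree theorems)

* complex conjugation `c ∈ Γ_ℚ` is a reflection on `E[p]`: `c² = 1` and `Fix(c) ⊂ E[p]` is a line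
  (`MatarNekovar2019.exists_complexConjugation_fixedLine`, from `det ρ̄_{E,p} = χ̄_p`, `χ̄_p(c) = -1`),
  so `c` acts neither as `1` nor as `-1` (`#E[p] = p²`, `card_torsionPoints_eq_sq_holds`);
* hence (group theory, `Representation.exists_trace_commutator_ne_two_of_natCard_eq_sq`:
  Gelbart's Step 2 / de Shalit's `2 × 2` computation) some commutator `g = c τ c⁻¹ τ⁻¹` acts on
  `E[p]` with trace `≠ 2`; being a commutator, `χ_M(g) = 1` for the mod-`M` cyclotomic character;
* the conditions "acts on `E[p]` as `g`" and "`χ_M = χ_M(g)`" define an open neighbourhood of `g`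
  (`isOpen_ker_galoisRepTorsion_holds`, `modNCyclotomicCharacter_eventually_eq_one`), which meets
  the dense set of arithmetic Frobenius elements at places outside `S ∪ {p} ∪ {ℓ ∣ M Δ_min}`
  (Chebotarev: `absoluteGaloisGroup.frobenius_dense` with the PROVED `chebotarev_artinRep_holds`);
* for such a Frobenius `φ` above `ℓ`: `χ_M(φ) = ℓ (mod M)`
  (`modNCyclotomicCharacter_eq_residueCard_of_isArithFrobAt`), so `ℓ ≡ 1 (mod M)`, and
  `tr ρ̄_{E,p}(φ) = a_ℓ (mod p)` (Serre's (238), `trace_galoisRepTorsion_frobenius_eq`), so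
  `a_ℓ ≢ 2 (mod p)`; finally `W.LFunction ℓ = a_ℓ` at a good prime
  (`LFunction_apply_prime_eq_frobeniusTrace`).

Consumed by the TQMP route of `Summits/BirchSwinnertonDyer` (support item
`IrrModThreeSplitTraceWitness`: the witness prime `p ≡ 1 (mod N_W)` with `a_p ≢ 2 (mod 3)` for the
Bezout step on the Prym defect); no summit statement is proved here.

## References

* J. Tate, *Global class field theory*, Ch. VII of Cassels–Fröhlich (eds.), *Algebraic Number
  Theory* (1967), §2.4 (Tchebotarev density theorem). [TateGCFT1967]
* J.-P. Serre, *Quelques applications du théorème de densité de Chebotarev*, Publ. Math. IHÉS 54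
  (1981), §8.1 eq. (238) (p. 188). [Serre1981]
* S. Gelbart, *Three lectures on the modularity of `ρ̄_{E,3}` and the Langlands reciprocity
  conjecture*, in *Modular Forms and Fermat's Last Theorem* (1997), Lecture I §1.4, proof of
  Prop. 1.4, Step 2 (PDF pp. 217–218). [Gelbart1997]
-/

noncomputable section

open scoped Classical
open NumberField IsDedekindDomain Field WeierstrassCurve Rat.HeightOneSpectrum

namespace Literature.NumberTheory.EllipticCurves

open Literature.NumberTheory.GaloisRepresentations
  Literature.RepresentationTheory.FiniteGroups

/-- `N v = ℓ` for the place `v` of `ℚ` over `ℓ` (a copy of the tree's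
`Rat.residueCard_eq_natGenerator`, kept here to keep the imports light). [folklore] -/
private theorem residueCard_eq_coe_primesEquiv (v : HeightOneSpectrum (𝓞 ℚ)) :
    v.residueCard = ((primesEquiv v : Nat.Primes) : ℕ) := by
  rw [v.residueCard_eq_card_quotient]
  have h : Ideal.span {(natGenerator v : ℤ)} =
      v.asIdeal.map (Rat.IsIntegralClosure.intEquiv (𝓞 ℚ) : 𝓞 ℚ →+* ℤ) :=
    span_natGenerator v
  rw [Nat.card_congr ((Ideal.quotientEquiv _ _ (Rat.IsIntegralClosure.intEquiv (𝓞 ℚ)) h).trans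
    (Int.quotientSpanNatEquivZMod _)).toEquiv, Nat.card_zmod]
  rfl

variable (W : WeierstrassCurve ℚ) [W.IsElliptic] [W.IsGloballyMinimal]

/-- **Irreducible `E[p]`, `p` odd: a good prime `ℓ ≡ 1 (mod M)` outside any finite set with
`a_ℓ(E) ≢ 2 (mod p)`.**  Let `E = W/ℚ` be an elliptic curve in global minimal form, `p ≠ 2` a
prime with `E[p]` irreducible, `M ≥ 1` and `S` a finite set of naturals.  Then there is a prime
`ℓ ∉ S`, `ℓ ≠ p`, `ℓ ∤ Δ_min(W)`, `ℓ ∤ M`, with `ℓ ≡ 1 (mod M)` and `p ∤ a_ℓ(W) - 2`.  Proof (module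
docstring): complex conjugation is a reflection on the `𝔽_p`-plane `E[p]` (Gelbart, Step 2:
`det ρ̄(τ) = -1` gives the eigenvalues `1, -1`, and with irreducibility a NON-ABELIAN image), so
some commutator `g = c τ c⁻¹ τ⁻¹` acts with trace `≠ 2`
(`Representation.exists_trace_commutator_ne_two_of_natCard_eq_sq`); `g` is killed by the mod-`M`
cyclotomic character; by Chebotarev (Tate §2.4; tree `absoluteGaloisGroup.frobenius_dense`) an
arithmetic Frobenius `φ` above some `ℓ` outside the excluded set acts on `E[p]` and on `μ_M` as
`g` does, whence `ℓ ≡ 1 (mod M)` and `a_ℓ ≡ tr ρ̄(φ) = tr ρ̄(g) ≢ 2 (mod p)` (Serre (238)).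
[cite: TateGCFT1967, §2.4 (Tchebotarev density theorem)] [cite: Serre1981, §8.1 eq. (238) (p. 188)]
[cite: Gelbart1997, Lecture I §1.4, proof of Prop. 1.4, Step 2 (PDF pp. 217–218)] -/
theorem exists_prime_modEq_one_not_dvd_frobeniusTrace_sub_two (p : ℕ) [Fact p.Prime]
    (hp2 : p ≠ 2) (hirr : W.HasIrreducibleModPGaloisRep p) (M : ℕ) [NeZero M] (S : Set ℕ)
    (hS : S.Finite) :
    ∃ ℓ : ℕ, ℓ.Prime ∧ ℓ ∉ S ∧ ℓ ≠ p ∧ ¬ (ℓ : ℤ) ∣ minimalDiscriminantInt W ∧ ¬ ℓ ∣ M ∧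
      ℓ ≡ 1 [MOD M] ∧ ¬ (p : ℤ) ∣ W.frobeniusTrace ℓ - 2 := by
  classical
  have hp : p.Prime := Fact.out
  letI : Module (ZMod p) (geomTorsion W p) := AddSubgroup.torsionBy.zmodModule
  haveI : NeZero ((M : ℕ) : ℚ) := NeZero.charZero
  have h2p : (2 : ZMod p) ≠ 0 := by
    intro h
    have h' : ((2 : ℕ) : ZMod p) = 0 := by rw [Nat.cast_two, h]
    rw [ZMod.natCast_eq_zero_iff] at h'
    exact hp2 ((Nat.prime_dvd_prime_iff_eq hp Nat.prime_two).mp h')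
  -- `E[p]` is an `𝔽_p`-plane
  have hcard : Nat.card (geomTorsion W p) = p ^ 2 :=
    card_torsionPoints_eq_sq_holds W (AlgebraicClosure ℚ) (n := p) (by exact_mod_cast hp.ne_zero)
  -- complex conjugation: `c² = 1`, fixed subgroup of order `p`
  obtain ⟨c, hcc, L, hL, hmemL⟩ := MatarNekovar2019.exists_complexConjugation_fixedLine W p hp2
  have hc1 : ∃ P : geomTorsion W p, c • P ≠ P := by
    by_contra h
    push Not at h
    have hLtop : L = ⊤ := (AddSubgroup.eq_top_iff' L).mpr fun P ↦ (hmemL P).mpr (h P)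
    have hc : Nat.card L = p ^ 2 := by rw [hLtop, AddSubgroup.card_top, hcard]
    rw [hL] at hc
    have h1 : p * 1 = p * p := by rw [mul_one, ← pow_two]; exact hc
    exact hp.one_lt.ne (Nat.eq_of_mul_eq_mul_left hp.pos h1)
  have hc2 : ∃ P : geomTorsion W p, c • P ≠ -P := by
    by_contra h
    push Not at h
    have hLbot : L = ⊥ := by
      refine (AddSubgroup.eq_bot_iff_forall _).mpr fun P hP ↦ ?_
      have hPP : P = -P := ((hmemL P).mp hP).symm.trans (h P)
      have h2 : (2 : ZMod p) • P = 0 := by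
        rw [two_smul]
        nth_rw 2 [hPP]
        exact add_neg_cancel P
      exact (smul_eq_zero.mp h2).resolve_left h2p
    have hc : Nat.card L = 1 := by rw [hLbot, AddSubgroup.card_bot]
    exact hp.one_lt.ne' (hL.symm.trans hc)
  -- group theory: a commutator with trace `≠ 2`
  obtain ⟨τ, hτ⟩ := Representation.exists_trace_commutator_ne_two_of_natCard_eq_sq
    (Γ := absoluteGaloisGroup ℚ) hcard hp2 hirr hcc hc1 hc2
  set g : absoluteGaloisGroup ℚ := c * τ * c⁻¹ * τ⁻¹ with hg_def
  -- the open neighbourhood `U` of `g`: same action on `E[p]`, same value of `χ_M`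
  let ρ := galoisRepTorsion W p
  let χ := modNCyclotomicCharacter ℚ M
  have hKρ : IsOpen ((ρ.ker : Subgroup (absoluteGaloisGroup ℚ)) : Set (absoluteGaloisGroup ℚ)) :=
    W.isOpen_ker_galoisRepTorsion_holds (n := (p : ℤ)) (by exact_mod_cast hp.ne_zero)
  have hKχ : IsOpen ((χ.ker : Subgroup (absoluteGaloisGroup ℚ)) : Set (absoluteGaloisGroup ℚ)) := by
    refine Subgroup.isOpen_of_mem_nhds χ.ker (g := 1) ?_
    have h := modNCyclotomicCharacter_eventually_eq_one ℚ M
    exact h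
  let U : Set (absoluteGaloisGroup ℚ) :=
    (fun σ ↦ g⁻¹ * σ) ⁻¹' (((ρ.ker : Subgroup _) : Set _) ∩ ((χ.ker : Subgroup _) : Set _))
  have hU : IsOpen U := (hKρ.inter hKχ).preimage (continuous_const.mul continuous_id)
  have hgU : g ∈ U := by
    change g⁻¹ * g ∈ ((ρ.ker : Subgroup _) : Set _) ∩ ((χ.ker : Subgroup _) : Set _)
    rw [inv_mul_cancel]
    exact ⟨one_mem _, one_mem _⟩
  -- the excluded places
  have hΔ0 : minimalDiscriminantInt W ≠ 0 := minimalDiscriminantInt_ne_zero W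
  let S' : Set ℕ := S ∪ {q | q = p ∨ (q : ℤ) ∣ minimalDiscriminantInt W ∨ q ∣ M}
  have hS' : S'.Finite := by
    refine hS.union ((Set.finite_le_nat
      (max p (max (minimalDiscriminantInt W).natAbs M))).subset ?_)
    rintro q (rfl | hq | hq)
    · exact Set.mem_setOf.mpr (le_max_left _ _)
    · exact Set.mem_setOf.mpr (le_max_of_le_right (le_max_of_le_left
        (Nat.le_of_dvd (Int.natAbs_pos.mpr hΔ0) (Int.natCast_dvd.mp hq))))
    · exact Set.mem_setOf.mpr (le_max_of_le_right (le_max_of_le_right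
        (Nat.le_of_dvd (Nat.pos_of_ne_zero (NeZero.ne M)) hq)))
  let S₀ : Set (HeightOneSpectrum (𝓞 ℚ)) := {v | ((primesEquiv v : Nat.Primes) : ℕ) ∈ S'}
  have hS₀ : S₀.Finite := by
    refine Set.Finite.preimage (f := fun v : HeightOneSpectrum (𝓞 ℚ) ↦
      ((primesEquiv v : Nat.Primes) : ℕ)) (Set.injOn_of_injective ?_) hS'
    intro v w hvw
    exact (primesEquiv (R := 𝓞 ℚ)).injective (Subtype.ext hvw)
  -- Chebotarev: a Frobenius in `U` above a place outside `S₀`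
  obtain ⟨φ, hφU, v, hvS₀, 𝔓, h𝔓, hφ⟩ :=
    (absoluteGaloisGroup.frobenius_dense Automorphic.chebotarev_artinRep_holds ℚ S₀ hS₀)
      |>.inter_open_nonempty U hU ⟨g, hgU⟩
  obtain ⟨hφρ, hφχ⟩ := hφU
  have hρφ : ρ g = ρ φ := inv_mul_eq_one.mp (by rw [← map_inv, ← map_mul]; exact hφρ)
  have hχφg : χ g = χ φ := inv_mul_eq_one.mp (by rw [← map_inv, ← map_mul]; exact hφχ)
  set ℓ : ℕ := ((primesEquiv v : Nat.Primes) : ℕ) with hℓ_def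
  have hℓ : ℓ.Prime := (primesEquiv v).2
  haveI : Fact ℓ.Prime := ⟨hℓ⟩
  have hℓS' : ℓ ∉ S' := hvS₀
  have hℓS : ℓ ∉ S := fun h ↦ hℓS' (Or.inl h)
  have hℓp : ℓ ≠ p := fun h ↦ hℓS' (Or.inr (Or.inl h))
  have hℓΔ : ¬ (ℓ : ℤ) ∣ minimalDiscriminantInt W := fun h ↦ hℓS' (Or.inr (Or.inr (Or.inl h)))
  have hℓM : ¬ ℓ ∣ M := fun h ↦ hℓS' (Or.inr (Or.inr (Or.inr h)))
  have hgood : W.HasGoodReductionAtPrime ℓ := hasGoodReductionAtPrime_of_not_dvd W ℓ hℓΔ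
  -- `χ_M(g) = 1` (a commutator) and `χ_M(φ) = ℓ`: so `ℓ ≡ 1 (mod M)`
  have hχg : χ g = 1 := by
    rw [hg_def, map_mul, map_mul, map_mul, map_inv, map_inv, mul_comm (χ c) (χ τ),
      mul_assoc (χ τ), mul_inv_cancel, mul_one, mul_inv_cancel]
  have hχφ : ((χ φ : (ZMod M)ˣ) : ZMod M) = ℓ := by
    have hN : (M : GaloisRepresentations.absIntegers (𝓞 ℚ) ℚ) ∉ 𝔓 :=
      Rat.natCast_not_mem_of_mem_primesAbove_of_not_dvd h𝔓 hℓM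
    rw [modNCyclotomicCharacter_eq_residueCard_of_isArithFrobAt (K := ℚ) (N := M) h𝔓 hN hφ,
      residueCard_eq_coe_primesEquiv]
  have hmod : ℓ ≡ 1 [MOD M] := by
    have h : ((ℓ : ℕ) : ZMod M) = ((1 : ℕ) : ZMod M) := by
      rw [← hχφ, ← hχφg, hχg, Units.val_one, Nat.cast_one]
    exact (ZMod.natCast_eq_natCast_iff ℓ 1 M).mp h
  -- `tr ρ̄(φ) = a_ℓ (mod p)` and `ρ̄(φ) = ρ̄(g)`
  have htr := W.trace_galoisRepTorsion_frobenius_eq p (p := ℓ) hℓp hgood hℓ_def.symm h𝔓 hφ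
  have hlin : (galoisRepTorsion W p φ).toAdd.toAddMonoidHom.toZModLinearMap p =
      (DistribSMul.toAddMonoidHom (geomTorsion W p) g).toZModLinearMap p := by
    apply LinearMap.ext
    intro P
    change (ρ φ).toAdd P = g • P
    rw [← hρφ]
    rfl
  rw [hlin] at htr
  refine ⟨ℓ, hℓ, hℓS, hℓp, hℓΔ, hℓM, hmod, fun hdvd ↦ hτ ?_⟩
  rw [htr]
  have h := (ZMod.intCast_zmod_eq_zero_iff_dvd (W.frobeniusTrace ℓ - 2) p).mpr hdvd
  push_cast at h
  exact sub_eq_zero.mp h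

/-- **At `p = 3`, in the shape consumed by the TQMP route**: if `E[3]` is irreducible then there
is a prime `ℓ ≠ 3` with `ℓ ≡ 1 (mod N_W)` and `3 ∤ a_ℓ(W) - 2`, where `a_ℓ = W.LFunction ℓ` is the
`ℓ`-th coefficient of `L(E, s)` (`= frobeniusTrace` at the good prime `ℓ`,
`LFunction_apply_prime_eq_frobeniusTrace`).
[cite: TateGCFT1967, §2.4 (Tchebotarev density theorem)] [cite: Serre1981, §8.1 eq. (238) (p. 188)]
[cite: Gelbart1997, Lecture I §1.4, proof of Prop. 1.4, Step 2 (PDF pp. 217–218)] -/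
theorem exists_prime_modEq_one_conductorNorm_not_three_dvd_lFunction_sub_two
    [NeZero (W.conductorNorm ℤ)] (hirr : W.HasIrreducibleModPGaloisRep 3) :
    ∃ (p : ℕ) (_ : p.Prime), p ≠ 3 ∧ p ≡ 1 [MOD W.conductorNorm ℤ] ∧
      ¬ (3 : ℤ) ∣ W.LFunction p - 2 := by
  haveI : Fact (3 : ℕ).Prime := ⟨Nat.prime_three⟩
  obtain ⟨ℓ, hℓ, -, hℓ3, hℓΔ, -, hmod, htr⟩ :=
    exists_prime_modEq_one_not_dvd_frobeniusTrace_sub_two W 3 (by norm_num) hirr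
      (W.conductorNorm ℤ) ∅ Set.finite_empty
  haveI : Fact ℓ.Prime := ⟨hℓ⟩
  refine ⟨ℓ, hℓ, hℓ3, hmod, ?_⟩
  rw [LFunction_apply_prime_eq_frobeniusTrace W ℓ (hasGoodReductionAtPrime_of_not_dvd W ℓ hℓΔ)]
  exact_mod_cast htr

end Literature.NumberTheory.EllipticCurves

end
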